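import Literature.NumberTheory.EllipticCurves.FunctionFieldUnramified
import Literature.NumberTheory.EllipticCurves.SelmerFiniteProofs
import HarnessLib

/-!
# The reduction step of Silverman AEC X.4.2(b)/X.4.4 at a place of a field
# (inertia fixes `P` when `n (P^σ - P) = O`, `v` good, `|n|_v = 1`)

Seventh decomposition file (D-0014/D-0026, provefact seat on
`Literature.NumberTheory.EllipticCurves.FunctionField.finite_shaPrimeToChar_torsionBy`, statement
file `FunctionField`, bsd.S33). The glue `FunctionFieldSelmerInertia.selmerGroup_le_h1Unramified_of_local`
needs, at every place `v` of good reduction, the **reduction step (RED)** of Silverman's proof of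
*The Arithmetic of Elliptic Curves*, Thm. X.4.2(b) / Cor. X.4.4: *for `σ` in the inertia group
`I_𝔐 ≤ Γ_{F_v}` of the (unique) prime `𝔐` of the local absolute integers `\bar O_{F_v} ⊆ F̄_v`
above `𝔪_{F_v}`, and `P ∈ E(F̄_v)` with `n (P^σ - P) = O`, `|n|_v = 1`, one has `P^σ = P`*
("`\widetilde{P^σ - P} = Õ` since inertia acts trivially on `Ẽ_v`, and `E[n]` injects into
`Ẽ_v`", VIII.1.4 = VII.3.1(b)). The tree proves it for number fields in `SelmerFiniteProofs`
(`smul_localPoints_eq_of_mem_inertia_holds`) from the abstract valuation-theoretic theorem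
`map_eq_of_inertia_of_zsmul_sub_eq_zero` of `GoodReductionInertia` (any valued field); this file
is the **copy for a place `v : Place F` of an arbitrary field** (a discrete valuation ring
`O_v ⊆ F`, completion `F_v = v.Completion`, file `FunctionFieldPlaces`), the only number-field
ingredient of the tree file — Mathlib's normed structure on `K_v` — being replaced by the
rank-one structure of the discrete valuation of `F_v` (`Valuation.IsRankOneDiscrete.rankOne`,
base `2`; a local instance) and the scoped `Valued.toNormedField`:

* §0 the local absolute integers, their prime and inertia group, valuation-theoretically
  (`ClosureValuation`, general section, for `L = F_v`);
* §1 the spectral valuation `|·|_v` on `F̄_v` (`exists_spectralValuation`), `Γ_{F_v}`-invariant,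
  with valuation ring `\bar O_{F_v}`, prime `{|b|_v < 1}`, inertia `{σ : |σ x - x|_v < 1}`; the
  hypothesis `|n|_v = 1` is `v.adicVal n = 1` (for a global function field and `n` invertible in
  `F` this holds at every place, `adicVal_eq_one_of_pow_eq_one`);
* §2 a good integral model at a place of good reduction (`HasGoodReductionAt v.spectrum`,
  `localMinimalModel`, `LocalReduction`);
* §3 the equivariant transport to the good model and the discharge
  `smul_localPoints_eq_of_mem_inertia` (Silverman X.§4, proof of Thm. 4.2(b), over `F_v`).

## References

* [SilvermanAEC2009] J. H. Silverman, *The Arithmetic of Elliptic Curves*, 2nd ed., X.§4 proof of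
  Thm. 4.2(b), VIII.§1 Prop. 1.4 (= VII.3.1(b)), VII.§1–§2.
* [NeukirchANT1999] J. Neukirch, *Algebraic Number Theory*, Ch. II (4.8), (6.2), §9 (9.3).

## Design

No `def … : Prop`; the only definition is the rank-one structure `Place.rankOneValuedCompletion`
(a local instance, base `2`), through which `open scoped Valued` equips `F_v` with Mathlib's
`Valued.toNormedField`; all statements about `F̄_v` are phrased with the explicit function
`spectralNorm F_v F̄_v`, as in `SelmerFiniteProofs`. `F : Type` (universe `0`, `Place F`).
-/

noncomputable section

open scoped Classical NNReal Valued Pointwise WithZero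
open IsDedekindDomain Polynomial

namespace Literature.NumberTheory.EllipticCurves.FunctionField

open Literature.NumberTheory.EllipticCurves Literature.NumberTheory.GaloisRepresentations Field
  WeierstrassCurve

variable {F : Type} [Field F]

namespace Place

/-- The rank-one structure (base `2`) on the discrete valuation of the completion `F_v` of a
field at a place (Mathlib's `Valuation.IsRankOneDiscrete.rankOne`); it makes `F_v` a normed
field through the scoped instance `Valued.toNormedField`. Neukirch, *ANT*, Ch. II §4
(`|x|_v = q^{-ord_v x}`; any base `> 1` gives an equivalent absolute value). [folklore] -/
@[reducible]
def rankOneValuedCompletion (v : Place F) : (Valued.v : Valuation v.Completion ℤᵐ⁰).RankOne :=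
  Valuation.IsRankOneDiscrete.rankOne _ one_lt_two

attribute [local instance] rankOneValuedCompletion

variable (v : Place F)

/-! ## §0. The local absolute integers, their prime and inertia group -/

/-- `O_{F_v} = {‖x‖ ≤ 1}`. [folklore] -/
theorem mem_completionIntegers_iff_norm_le_one (x : v.Completion) :
    x ∈ v.CompletionIntegers ↔ ‖x‖ ≤ 1 := by
  rw [HeightOneSpectrum.mem_adicCompletionIntegers, Valued.toNormedField.norm_le_one_iff]

/-- The local absolute integers `integralClosure O_{F_v} F̄_v` are the elements of `F̄_v` of
spectral norm `≤ 1` (`mem_absIntegers_iff_spectralNorm_le_one` for `L = F_v`).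
[cite: NeukirchANT1999, Ch. II (4.8)] -/
theorem mem_absIntegers_completion_iff {x : AlgebraicClosure v.Completion} :
    x ∈ absIntegers v.CompletionIntegers v.Completion ↔
      spectralNorm v.Completion (AlgebraicClosure v.Completion) x ≤ 1 :=
  mem_absIntegers_iff_spectralNorm_le_one v.CompletionIntegers
    (mem_completionIntegers_iff_norm_le_one v)

/-- A prime of the local absolute integers above `𝔪_{F_v}` is the open unit ball of the
spectral norm (`mem_iff_spectralNorm_lt_one` for `L = F_v`). [cite: NeukirchANT1999, Ch. II (4.8)] -/
theorem mem_iff_spectralNorm_lt_one_completion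
    {𝔐 : Ideal (absIntegers v.CompletionIntegers v.Completion)} [𝔐.IsPrime]
    [𝔐.LiesOver (IsLocalRing.maximalIdeal v.CompletionIntegers)]
    (b : absIntegers v.CompletionIntegers v.Completion) :
    b ∈ 𝔐 ↔ spectralNorm v.Completion (AlgebraicClosure v.Completion) b < 1 :=
  mem_iff_spectralNorm_lt_one v.CompletionIntegers (mem_completionIntegers_iff_norm_le_one v) b

/-- `σ ∈ Γ_{F_v}` lies in the local inertia group `I_𝔐` iff `‖σ b - b‖ < 1` for all `b` with
`‖b‖ ≤ 1` (spectral norm; `mem_inertia_iff_spectralNorm` for `L = F_v`).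
[cite: NeukirchANT1999, Ch. II (9.3) Definition] -/
theorem mem_inertia_iff_spectralNorm_completion
    {𝔐 : Ideal (absIntegers v.CompletionIntegers v.Completion)} [𝔐.IsPrime]
    [𝔐.LiesOver (IsLocalRing.maximalIdeal v.CompletionIntegers)]
    {σ : absoluteGaloisGroup v.Completion} :
    σ ∈ 𝔐.inertia (absoluteGaloisGroup v.Completion) ↔
      ∀ b : AlgebraicClosure v.Completion,
        spectralNorm v.Completion (AlgebraicClosure v.Completion) b ≤ 1 →
        spectralNorm v.Completion (AlgebraicClosure v.Completion) (σ • b - b) < 1 :=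
  mem_inertia_iff_spectralNorm v.CompletionIntegers (mem_completionIntegers_iff_norm_le_one v)

/-! ## §1. The spectral valuation on `F̄_v` -/

/-- **The valuation `|·|_v` on `F̄_v`** (values in `ℝ≥0`): the spectral norm of the complete
non-archimedean field `F_v` on `F̄_v` is a valuation. Neukirch, *ANT*, Ch. II Thm. (4.8).
[cite: NeukirchANT1999, Ch. II Thm. (4.8)] -/
theorem exists_spectralValuation :
    ∃ w : Valuation (AlgebraicClosure v.Completion) ℝ≥0,
      ∀ x, (w x : ℝ) = spectralNorm v.Completion (AlgebraicClosure v.Completion) x := by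
  let N : MulAlgebraNorm v.Completion (AlgebraicClosure v.Completion) :=
    spectralMulAlgNorm v.Completion (AlgebraicClosure v.Completion)
  refine ⟨{ toFun := fun x ↦ ⟨N x, apply_nonneg N x⟩
            map_zero' := Subtype.ext (map_zero N)
            map_one' := Subtype.ext N.map_one'
            map_mul' := fun x y ↦ Subtype.ext (map_mul N x y)
            map_add_le_max' := fun x y ↦ ?_ }, fun x ↦ rfl⟩
  rw [← NNReal.coe_le_coe, NNReal.coe_max]
  exact isNonarchimedean_spectralNorm x y

section SpectralValuation

variable {v} {w : Valuation (AlgebraicClosure v.Completion) ℝ≥0}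
  (hw : ∀ x, (w x : ℝ) = spectralNorm v.Completion (AlgebraicClosure v.Completion) x)
include hw

/-- The spectral valuation extends the norm of `F_v`. [folklore] -/
theorem coe_spectralValuation_algebraMap (a : v.Completion) :
    (w (algebraMap v.Completion _ a) : ℝ) = ‖a‖ := by
  rw [hw, spectralNorm_extends]

/-- An element of `F_v` has spectral valuation `≤ 1` iff it lies in `O_{F_v}`. [folklore] -/
theorem spectralValuation_algebraMap_le_one_iff (a : v.Completion) :
    w (algebraMap v.Completion _ a) ≤ 1 ↔ a ∈ v.CompletionIntegers := by
  rw [← NNReal.coe_le_coe, coe_spectralValuation_algebraMap hw, NNReal.coe_one,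
    Valued.toNormedField.norm_le_one_iff, HeightOneSpectrum.mem_adicCompletionIntegers]

/-- Galois invariance: `|σ x|_v = |x|_v` for `σ ∈ Γ_{F_v}`. Neukirch, *ANT*, Ch. II (4.8).
[folklore] -/
theorem spectralValuation_smul (σ : absoluteGaloisGroup v.Completion)
    (x : AlgebraicClosure v.Completion) : w (σ • x) = w x :=
  NNReal.coe_injective (by rw [hw, hw]; exact spectralNorm_absoluteGaloisGroup_smul σ x)

/-- The local absolute integers are the valuation ring of `|·|_v`. Neukirch, *ANT*, II (6.2).
[folklore] -/
theorem mem_absIntegers_iff_spectralValuation {x : AlgebraicClosure v.Completion} :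
    x ∈ absIntegers v.CompletionIntegers v.Completion ↔ w x ≤ 1 := by
  rw [← NNReal.coe_le_coe, hw, NNReal.coe_one]
  exact mem_absIntegers_completion_iff v

/-- **The inertia group of `F̄_v/F_v`, valuation-theoretically**: for a prime `𝔐` of the local
absolute integers above `𝔪_{F_v}`, `σ ∈ I_𝔐` iff `|σ x - x|_v < 1` whenever `|x|_v ≤ 1`.
Neukirch, *ANT*, Ch. II §9 (9.3). [folklore] -/
theorem mem_inertia_iff_spectralValuation
    {𝔐 : Ideal (absIntegers v.CompletionIntegers v.Completion)} [𝔐.IsPrime]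
    [𝔐.LiesOver (IsLocalRing.maximalIdeal v.CompletionIntegers)]
    {σ : absoluteGaloisGroup v.Completion} :
    σ ∈ 𝔐.inertia (absoluteGaloisGroup v.Completion) ↔
      ∀ x : AlgebraicClosure v.Completion, w x ≤ 1 → w (σ • x - x) < 1 := by
  rw [mem_inertia_iff_spectralNorm_completion v]
  refine forall_congr' fun x ↦ ?_
  rw [← NNReal.coe_le_coe, ← NNReal.coe_lt_coe, hw, hw, NNReal.coe_one]

/-- An element of `F` with `v`-adic valuation `1` has spectral valuation `1` in `F̄_v`.
[folklore] -/
theorem spectralValuation_algebraMap_eq_one {x : F} (hx : v.adicVal x = 1) :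
    w (algebraMap F (AlgebraicClosure v.Completion) x) = 1 := by
  apply NNReal.coe_injective
  rw [IsScalarTower.algebraMap_apply F v.Completion (AlgebraicClosure v.Completion),
    coe_spectralValuation_algebraMap hw, NNReal.coe_one]
  have hv : Valued.v (algebraMap F v.Completion x) = 1 := by
    change Valued.v ((x : F) : v.Completion) = 1
    rw [HeightOneSpectrum.valuedAdicCompletion_eq_valuation']
    exact hx
  apply le_antisymm
  · rw [Valued.toNormedField.norm_le_one_iff, hv]
  · rw [Valued.toNormedField.one_le_norm_iff, hv]

/-- An integer `n` with `|n|_v = 1` (`v.adicVal n = 1`) has spectral valuation `1` in `F̄_v`.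
Silverman, *AEC*, VII.3.1 / VIII.1.4 (the hypothesis "`v ∤ m`"). [folklore] -/
theorem spectralValuation_intCast_eq_one {n : ℤ} (hn : v.adicVal (n : F) = 1) :
    w (n : AlgebraicClosure v.Completion) = 1 := by
  rw [← map_intCast (algebraMap F (AlgebraicClosure v.Completion)) n]
  exact spectralValuation_algebraMap_eq_one hw hn

/-- A unit of `O_{F_v}` has valuation `1` in `F̄_v`. [folklore] -/
theorem spectralValuation_eq_one_of_isUnit {a : v.CompletionIntegers} (ha : IsUnit a) :
    w (algebraMap v.Completion (AlgebraicClosure v.Completion)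
      (algebraMap v.CompletionIntegers v.Completion a)) = 1 := by
  obtain ⟨u, rfl⟩ := ha
  set f : v.CompletionIntegers →+* AlgebraicClosure v.Completion :=
    (algebraMap v.Completion (AlgebraicClosure v.Completion)).comp
      (algebraMap v.CompletionIntegers v.Completion)
  have hle : ∀ a : v.CompletionIntegers, w (f a) ≤ 1 :=
    fun a ↦ (spectralValuation_algebraMap_le_one_iff hw _).mpr a.2
  change w (f u) = 1
  refine le_antisymm (hle _) ?_
  have h1 : w (f u) * w (f ↑u⁻¹) = 1 := by
    rw [← map_mul, ← map_mul, Units.mul_inv, map_one, map_one]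
  calc (1 : ℝ≥0) = _ := h1.symm
    _ ≤ w (f u) := mul_le_of_le_one_right' (hle _)

end SpectralValuation

/-- **`|x|_v = 1` for a root of unity**: an element of `F` with `x ^ m = 1`, `m ≥ 1`, has
`v`-adic valuation `1` at every place. In a field of characteristic `p`, a nonzero integer `n`
is such an element (`n^{p-1} = 1`), so "`n` invertible in `F`" gives `|n|_v = 1` at every
place. [folklore] -/
theorem adicVal_eq_one_of_pow_eq_one {x : F} {m : ℕ} (hm : 0 < m) (hx : x ^ m = 1) :
    v.adicVal x = 1 := by
  have h : v.adicVal x ^ m = 1 := by rw [← map_pow, hx, map_one]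
  exact (pow_eq_one_iff_left hm.ne').mp h

/-- In characteristic `p > 0`, an integer invertible in `F` has `|n|_v = 1` at every place
(`n` reduces to a unit of `ℤ/p`, so `n^{p-1} = 1` in `F`). [folklore] -/
theorem adicVal_intCast_eq_one (p : ℕ) [Fact p.Prime] [CharP F p] {n : ℤ} (hn : (n : F) ≠ 0) :
    v.adicVal (n : F) = 1 := by
  have hp : p.Prime := Fact.out
  let φ : ZMod p →+* F := ZMod.castHom (dvd_refl p) F
  have hφ : φ (n : ZMod p) = (n : F) := map_intCast φ n
  have hu : (n : ZMod p) ≠ 0 := by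
    intro h
    apply hn
    rw [← hφ, h, map_zero]
  have hpow : (n : F) ^ (p - 1) = 1 := by
    rw [← hφ, ← map_pow, ZMod.pow_card_sub_one_eq_one hu, map_one]
  exact adicVal_eq_one_of_pow_eq_one v (Nat.sub_pos_of_lt hp.one_lt) hpow

end Place

/-! ## §2. A good integral model at a place of good reduction -/

section Model

variable (W : WeierstrassCurve F)

attribute [local instance] Place.rankOneValuedCompletion

/-- At a place of good reduction there is a change of variables over `F_v` carrying `E/F_v` to
the base change of a Weierstrass equation over `O_{F_v}` with unit discriminant (a minimal
model; Mathlib `exists_isMinimal`, `integralModel`, `HasGoodReduction`; tree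
`localMinimalModel`, `HasGoodReductionAt` of `LocalReduction` for the Dedekind domain `O_v`).
Silverman, *AEC*, VII.§1 and VII.5.1(a). [folklore] -/
theorem exists_integralModel_of_hasGoodReductionAt {v : Place F}
    (hv : W.HasGoodReductionAt v.spectrum) :
    ∃ (C : VariableChange v.Completion) (M : WeierstrassCurve v.CompletionIntegers),
      C • W.baseChange v.Completion =
          M.map (algebraMap v.CompletionIntegers v.Completion) ∧ IsUnit M.Δ := by
  haveI : (W.localMinimalModel v.spectrum).HasGoodReduction v.CompletionIntegers := hv
  refine ⟨((W.baseChange v.Completion).exists_isMinimal v.CompletionIntegers).choose,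
    (W.localMinimalModel v.spectrum).integralModel v.CompletionIntegers, ?_, ?_⟩
  · exact (baseChange_integralModel_eq v.CompletionIntegers (W.localMinimalModel v.spectrum)).symm
  · have hell := (hasGoodReduction_iff_isElliptic_reduction
      (R := v.CompletionIntegers) (W := W.localMinimalModel v.spectrum)).mp hv
    have hu := hell.isUnit
    rw [reduction, map_Δ] at hu
    exact (isUnit_map_iff (IsLocalRing.residue _) _).mp hu

variable {v : Place F} {w : Valuation (AlgebraicClosure v.Completion) ℝ≥0}
  (hw : ∀ x, (w x : ℝ) = spectralNorm v.Completion (AlgebraicClosure v.Completion) x)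
include hw

omit W in
/-- The base change to `F̄_v` of a Weierstrass equation over `O_{F_v}` is integral for the
spectral valuation (Mathlib `WeierstrassCurve.IsIntegral w.integer`). Silverman, *AEC*, VII.§1.
[folklore] -/
theorem isIntegral_spectralValuation_baseChange (M : WeierstrassCurve v.CompletionIntegers) :
    ((M.map (algebraMap v.CompletionIntegers v.Completion)).baseChange
        (AlgebraicClosure v.Completion)).IsIntegral w.integer := by
  have key : ∀ a : v.CompletionIntegers,
      w (algebraMap v.Completion (AlgebraicClosure v.Completion)
        (algebraMap v.CompletionIntegers v.Completion a)) ≤ 1 :=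
    fun a ↦ (Place.spectralValuation_algebraMap_le_one_iff hw _).mpr a.2
  exact isIntegral_integer_of_val_le_one (key _) (key _) (key _) (key _) (key _)

omit W in
/-- The discriminant of the base change to `F̄_v` of an `O_{F_v}`-model with unit discriminant
has spectral valuation `1`. [folklore] -/
theorem spectralValuation_Δ_baseChange {M : WeierstrassCurve v.CompletionIntegers}
    (hΔ : IsUnit M.Δ) :
    w ((M.map (algebraMap v.CompletionIntegers v.Completion)).baseChange
        (AlgebraicClosure v.Completion)).Δ = 1 := by
  rw [baseChange, map_Δ, map_Δ]
  exact Place.spectralValuation_eq_one_of_isUnit hw hΔ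

end Model

/-! ## §3. Transport of `E(F̄_v)` to the good model; the discharge -/

section Discharge

variable (W : WeierstrassCurve F) (v : Place F)

attribute [local instance] Place.rankOneValuedCompletion

/-- `(W_{F_v})_{F̄_v} = W_{F̄_v}`. [folklore] -/
theorem baseChange_baseChange_completion :
    (W.baseChange v.Completion).baseChange (AlgebraicClosure v.Completion) =
      W.baseChange (AlgebraicClosure v.Completion) :=
  W.map_baseChange (Algebra.ofId v.Completion (AlgebraicClosure v.Completion))

/-- The transport `E(F̄_v) = W_{F̄_v}(F̄_v) → (W_{F_v})_{F̄_v}(F̄_v)` (identity on coordinates)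
intertwines the action of `σ ∈ Γ_{F_v}` on `E(F̄_v)` (file `Sha`) with `Point.map σ`.
Silverman, *AEC*, VIII.§1. [folklore] -/
theorem congrEquiv_smul (σ : absoluteGaloisGroup v.Completion) (P : localPoints W v.Completion) :
    Affine.Point.congrEquiv (baseChange_baseChange_completion W v).symm (σ • P) =
      Affine.Point.map ((absoluteGaloisGroup.toAlgEquiv _ σ :
          AlgebraicClosure v.Completion ≃ₐ[v.Completion] AlgebraicClosure v.Completion) :
          AlgebraicClosure v.Completion →ₐ[v.Completion] AlgebraicClosure v.Completion)
        (Affine.Point.congrEquiv (baseChange_baseChange_completion W v).symm P) := by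
  rcases P with _ | ⟨x, y, hxy⟩
  · change Affine.Point.congrEquiv _ (σ • (0 : localPoints W v.Completion)) =
      Affine.Point.map _ (Affine.Point.congrEquiv _ 0)
    rw [smul_zero, Affine.Point.congrEquiv_zero, map_zero]
    exact Affine.Point.congrEquiv_zero _
  · rw [localPoints.smul_def]
    change Affine.Point.congrEquiv _ (Affine.Point.map _ (Affine.Point.some x y hxy)) = _
    rw [Affine.Point.map_some, Affine.Point.congrEquiv_some, Affine.Point.congrEquiv_some,
      Affine.Point.map_some]
    rfl

variable {W v}

/-- **Silverman, AEC X.§4 (proof of Thm. 4.2(b)), the reduction step (RED) at a place of a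
field.** For an elliptic curve `E/F`, a place `v` of good reduction (`v ∉ badPlaces W`), an
integer `n` with `|n|_v = 1` (`v.adicVal n = 1`), a prime `𝔐` of the local absolute integers
`\bar O_{F_v}` above `𝔪_{F_v}`, `σ` in the inertia group `I_𝔐 ≤ Γ_{F_v}` and `P ∈ E(F̄_v)` with
`n (P^σ - P) = O`, one has `P^σ = P`. Proof: move to a minimal (good) model `M` over `O_{F_v}`
by a change of variables `C` over `F_v` — the induced isomorphism `E(F̄_v) ≃ M(F̄_v)` is
`Γ_{F_v}`-equivariant since `C` has coefficients in `F_v` — and apply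
`map_eq_of_inertia_of_zsmul_sub_eq_zero` (`GoodReductionInertia`: VII.3.1 via division
polynomials and the relevant cases of VII.2.1) to `M_{F̄_v}` and the spectral valuation `|·|_v`
(`M_{F̄_v}` is integral with `|Δ|_v = 1`, `σ` is an isometry with `|σ z - z|_v < 1` on integers,
`|n|_v = 1`). The tree's `smul_localPoints_eq_of_mem_inertia_holds` (number fields) for a place.
[cite: SilvermanAEC2009, X.§4 proof of Thm. 4.2(b), via VIII.1.4 = VII.3.1(b)] -/
theorem smul_localPoints_eq_of_mem_inertia [W.IsElliptic] (hv : v ∉ badPlaces W) {n : ℤ}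
    (hn : v.adicVal (n : F) = 1) {𝔐 : Ideal (absIntegers v.CompletionIntegers v.Completion)}
    [𝔐.IsPrime] [𝔐.LiesOver (IsLocalRing.maximalIdeal v.CompletionIntegers)]
    {σ : absoluteGaloisGroup v.Completion} (hσ : σ ∈ 𝔐.inertia (absoluteGaloisGroup v.Completion))
    {P : localPoints W v.Completion} (hP : n • (σ • P - P) = 0) : σ • P = P := by
  have hgood : W.HasGoodReductionAt v.spectrum := by
    by_contra h
    exact hv h
  obtain ⟨C, M, hCM, hΔ⟩ := exists_integralModel_of_hasGoodReductionAt W hgood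
  obtain ⟨w, hw⟩ := v.exists_spectralValuation
  -- notation: `E = F_v`, `L = F̄_v`, `σE = σ` as an `F_v`-automorphism of `L`
  set E := v.Completion
  set L := AlgebraicClosure v.Completion
  set σE : L ≃ₐ[E] L := absoluteGaloisGroup.toAlgEquiv _ σ with hσE
  have hσ₁ : ∀ z : L, w (σE z) = w z := fun z ↦ Place.spectralValuation_smul hw σ z
  have hσ₂ : ∀ z : L, w z ≤ 1 → w (σE z - z) < 1 :=
    (Place.mem_inertia_iff_spectralValuation hw).mp hσ
  have hn' : w (n : L) = 1 := Place.spectralValuation_intCast_eq_one hw hn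
  haveI := isIntegral_spectralValuation_baseChange hw M
  -- transport to the good model `M_{F_v} = C • W_{F_v}`, equivariantly
  have hCM' := congrArg (fun X : WeierstrassCurve E ↦ X.baseChange L) hCM
  let Φ : localPoints W E ≃+
      ((M.map (algebraMap v.CompletionIntegers E)).baseChange L).toAffine.Point :=
    ((Affine.Point.congrEquiv (baseChange_baseChange_completion W v).symm).trans
      (VariableChange.pointEquivBaseChange (W.baseChange E) C L)).trans
      (Affine.Point.congrEquiv hCM')
  have hΦ : ∀ Q : localPoints W E, Φ (σ • Q) = Affine.Point.map (σE : L →ₐ[E] L) (Φ Q) := by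
    intro Q
    change Affine.Point.congrEquiv hCM' (VariableChange.pointEquivBaseChange (W.baseChange E) C L
        (Affine.Point.congrEquiv (baseChange_baseChange_completion W v).symm (σ • Q))) =
      Affine.Point.map (σE : L →ₐ[E] L) (Affine.Point.congrEquiv hCM'
        (VariableChange.pointEquivBaseChange (W.baseChange E) C L
          (Affine.Point.congrEquiv (baseChange_baseChange_completion W v).symm Q)))
    rw [congrEquiv_smul, VariableChange.pointEquivBaseChange_map_algEquiv, hσE]
    exact Affine.Point.congrEquiv_baseChange_map hCM _ _
  have key := Literature.NumberTheory.EllipticCurves.map_eq_of_inertia_of_zsmul_sub_eq_zero (w := w)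
    (M.map (algebraMap v.CompletionIntegers E))
    (spectralValuation_Δ_baseChange hw hΔ) σE hσ₁ hσ₂ hn' (P := Φ P) (by
      rw [← hΦ, ← map_sub, ← map_zsmul, hP, map_zero])
  apply Φ.injective
  rw [hΦ]
  exact key

end Discharge

end Literature.NumberTheory.EllipticCurves.FunctionField

end
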